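import Mathlib.Analysis.SpecialFunctions.SmoothTransition
import Literature.MathematicalPhysics.QuantumLattice.SchwartzFourierDensity
import HarnessLib

/-!
# Translates, localisation and a lattice partition of unity on Schwartz space

Trunk **T-AQFT** (support file for the Schwartz kernel theorem behind the named fact
`Literature.MathematicalPhysics.QuantumLattice.SchwartzTensor.existsUnique_schwingerFamilyOf`,
consumed by the planned `SchwartzKernelLocal` / `SchwartzKernelTheorem`), families
`constructive-qft`, `crit-ising`.

Quantitative facts about translation `f ↦ f(· - a)` (`SchwartzMap.compSubConstCLM`) and
multiplication by smooth cutoffs (`SchwartzMap.smulLeftCLM`) on a Schwartz space `𝓢(V, F)`, and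
the smooth lattice partition of unity used to pass from the local (box) form of the kernel
theorem to the global one:

* `seminorm_compSubConstCLM_le`, `exists_bound_seminorm_compSubConstCLM`: the Schwartz seminorms
  of a translate grow at most polynomially in the translation vector,
  `‖f(· - a)‖_{k,l} ≤ (2(1 + ‖a‖))^k · sup_{(k',l') ≤ (k,l)} ‖f‖_{k',l'}`;
* `exists_bound_seminorm_smulLeftCLM_compSubConstCLM` (finite-family form
  `exists_bound_sup_seminorm_smulLeftCLM_compSubConstCLM`): for a smooth compactly supported
  cutoff `χ`, the localised translates `χ · f(· - a)` decay faster than any power of `‖a‖` in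
  every seminorm, `‖χ · f(· - a)‖_{k,l} (1 + ‖a‖)^N ≤ C · sup_{(k',l') ≤ (N,l)} ‖f‖_{k',l'}`
  (Schwartz decay of `f` at distance `≍ ‖a‖` on the bounded support of `χ`);
* `tendsto_smulLeftCLM_of_eq_one`: cutoffs `W_i` with derivatives bounded uniformly in `i` and
  `W_i = 1` on balls of radii `r_i → ∞` can be removed, `W_i · f → f` in `𝓢(V, F)` (the usual
  proof that `C_c^∞` is dense in `𝒮`);
* the partition of unity: the bump `pouBump = ρ`, `ρ(t) = σ(t + 1) - σ(t)` with
  `σ = Real.smoothTransition`, whose integer translates telescope (`sum_Icc_pouBump`) to the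
  windows `pouWindow R`, equal to `1` on `[-R, R]`; on a finite-dimensional `E` with linear
  coordinates `Λ : E ≃L[ℝ] ℝᵐ`, the products `latticeBump Λ β`, `η_β(y) = ∏_c ρ(Λ(y)_c - β_c)`,
  `β ∈ ℤᵐ` — smooth, nonnegative, compactly supported, translates of `η_0` by the lattice vectors
  `Λ⁻¹β` (`latticeBump_eq_comp_sub`) — sum over the discrete cubes `latticeCube m R = [-R, R]ᵐ ∩ ℤᵐ`
  to the windows `latticeWindow Λ R` (`sum_latticeCube_latticeBump`), which have derivatives
  bounded uniformly in `R` (`exists_bound_iteratedFDeriv_latticeWindow`) and equal `1` on balls of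
  radius `≍ R` (`latticeWindow_eq_one`); hence `W_R · g → g` in `𝓢(E, F)`
  (`tendsto_latticeWindow_smul`): the partition `∑_β η_β = 1` converges on Schwartz space.

## Sources

Textbook folklore (the partition-of-unity / localisation step in proofs of the Schwartz kernel
theorem and of the density of `C_c^∞` in `𝒮`); the proofs are self-contained on top of Mathlib.

## Mathlib and Literature

Used from Mathlib: `SchwartzMap.compSubConstCLM`, `iteratedFDeriv_comp_sub'`,
`SchwartzMap.one_add_le_sup_seminorm_apply`, `SchwartzMap.smulLeftCLM` (with
`Function.HasTemperateGrowth`), `norm_iteratedFDeriv_mul_le`, `norm_iteratedFDeriv_smul_le`,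
`Real.smoothTransition` (`zero_of_nonpos`, `one_of_one_le`, `contDiff`),
`ContinuousLinearMap.iteratedFDeriv_comp_right`. From the tree: `Literature.MathematicalPhysics.QuantumLattice.intVec`
(`SchwartzFourierDensity`, the lattice vectors). Searched and absent at the pin: growth of
Schwartz seminorms under translation, partitions of unity acting on `SchwartzMap`
(`SmoothPartitionOfUnity` is not tied to Schwartz seminorm estimates).
-/

open scoped SchwartzMap Topology ContDiff
open Filter Set

noncomputable section

namespace Literature.MathematicalPhysics.QuantumLattice

/-! ### Seminorms of translates -/

section Translate

variable {V F : Type*} [NormedAddCommGroup V] [NormedSpace ℝ V]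
  [NormedAddCommGroup F] [NormedSpace ℝ F]
variable (𝕜 : Type*) [RCLike 𝕜] [NormedSpace 𝕜 F] [SMulCommClass ℝ 𝕜 F]

omit [NormedSpace ℝ V] in
/-- `‖x‖ ≤ (1 + ‖a‖)(1 + ‖x - a‖)`. [folklore] -/
theorem norm_le_one_add_mul_one_add_sub (x a : V) : ‖x‖ ≤ (1 + ‖a‖) * (1 + ‖x - a‖) := by
  have h1 : ‖x‖ ≤ ‖x - a‖ + ‖a‖ := by
    calc ‖x‖ = ‖(x - a) + a‖ := by rw [sub_add_cancel]
      _ ≤ ‖x - a‖ + ‖a‖ := norm_add_le _ _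
  nlinarith [norm_nonneg (x - a), norm_nonneg a]

/-- **Seminorms of a translate grow polynomially**: `‖f(· - a)‖_{k,l} ≤ (2(1 + ‖a‖))^k sup_{(k',l') ≤ (k,l)} ‖f‖_{k',l'}`.
[folklore] -/
theorem seminorm_compSubConstCLM_le (k l : ℕ) (a : V) (f : 𝓢(V, F)) :
    SchwartzMap.seminorm 𝕜 k l (SchwartzMap.compSubConstCLM 𝕜 a f) ≤
      (2 * (1 + ‖a‖)) ^ k * (Finset.Iic (k, l)).sup (schwartzSeminormFamily 𝕜 V F) f := by
  refine SchwartzMap.seminorm_le_bound 𝕜 k l _ (by positivity) fun x => ?_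
  have hcoe : (SchwartzMap.compSubConstCLM 𝕜 a f : V → F) = fun z => f (z - a) := rfl
  rw [hcoe, iteratedFDeriv_comp_sub']
  have hx : ‖x‖ ≤ (1 + ‖a‖) * (1 + ‖x - a‖) := norm_le_one_add_mul_one_add_sub x a
  have hsup : (1 + ‖x - a‖) ^ k * ‖iteratedFDeriv ℝ l f (x - a)‖ ≤
      2 ^ k * (Finset.Iic (k, l)).sup (schwartzSeminormFamily 𝕜 V F) f :=
    SchwartzMap.one_add_le_sup_seminorm_apply (𝕜 := 𝕜) (m := (k, l)) (k := k) (n := l)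
      le_rfl le_rfl f (x - a)
  calc ‖x‖ ^ k * ‖iteratedFDeriv ℝ l f (x - a)‖
      ≤ ((1 + ‖a‖) * (1 + ‖x - a‖)) ^ k * ‖iteratedFDeriv ℝ l f (x - a)‖ := by gcongr
    _ = (1 + ‖a‖) ^ k * ((1 + ‖x - a‖) ^ k * ‖iteratedFDeriv ℝ l f (x - a)‖) := by
        rw [mul_pow]; ring
    _ ≤ (1 + ‖a‖) ^ k * (2 ^ k * (Finset.Iic (k, l)).sup (schwartzSeminormFamily 𝕜 V F) f) :=
        mul_le_mul_of_nonneg_left hsup (by positivity)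
    _ = (2 * (1 + ‖a‖)) ^ k * (Finset.Iic (k, l)).sup (schwartzSeminormFamily 𝕜 V F) f := by
        rw [mul_pow]; ring

/-- Each seminorm of index `≤ (K, L)` coordinatewise is bounded by the `Iic (K, L)` supremum. [folklore] -/
theorem schwartzSeminorm_le_sup_Iic {K L k l : ℕ} (hk : k ≤ K) (hl : l ≤ L) (f : 𝓢(V, F)) :
    SchwartzMap.seminorm 𝕜 k l f ≤ (Finset.Iic (K, L)).sup (schwartzSeminormFamily 𝕜 V F) f := by
  have h := Finset.le_sup (f := schwartzSeminormFamily 𝕜 V F) (Finset.mem_Iic.2 (Prod.mk_le_mk.2 ⟨hk, hl⟩))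
  exact Seminorm.le_def.1 h f

/-- The `Iic` suprema are monotone in the corner. [folklore] -/
theorem sup_Iic_schwartzSeminorm_mono {K L K' L' : ℕ} (hk : K ≤ K') (hl : L ≤ L') (f : 𝓢(V, F)) :
    (Finset.Iic (K, L)).sup (schwartzSeminormFamily 𝕜 V F) f ≤
      (Finset.Iic (K', L')).sup (schwartzSeminormFamily 𝕜 V F) f :=
  Seminorm.le_def.1 (Finset.sup_mono (Finset.Iic_subset_Iic.2 (Prod.mk_le_mk.2 ⟨hk, hl⟩))) f

/-- **Uniform polynomial bound for translates on a finite family of seminorms**: for every finite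
set `s` of seminorm indices there are `C, k` and a finite set `s'` with
`sup_s ‖f(· - a)‖ ≤ C (1 + ‖a‖)^k sup_{s'} ‖f‖` for all `a` and `f`. [folklore] -/
theorem exists_bound_seminorm_compSubConstCLM (s : Finset (ℕ × ℕ)) :
    ∃ (C : ℝ) (k : ℕ) (s' : Finset (ℕ × ℕ)), 0 ≤ C ∧ ∀ (a : V) (f : 𝓢(V, F)),
      (s.sup (schwartzSeminormFamily 𝕜 V F)) (SchwartzMap.compSubConstCLM 𝕜 a f) ≤
        C * (1 + ‖a‖) ^ k * (s'.sup (schwartzSeminormFamily 𝕜 V F)) f := by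
  set K : ℕ := s.sup Prod.fst with hK
  set L : ℕ := s.sup Prod.snd with hL
  refine ⟨2 ^ K, K, Finset.Iic (K, L), by positivity, fun a f => ?_⟩
  refine Seminorm.finset_sup_apply_le (by positivity) fun i hi => ?_
  have hi1 : i.1 ≤ K := Finset.le_sup (f := Prod.fst) hi
  have hi2 : i.2 ≤ L := Finset.le_sup (f := Prod.snd) hi
  rw [SchwartzMap.schwartzSeminormFamily_apply]
  refine (seminorm_compSubConstCLM_le 𝕜 i.1 i.2 a f).trans ?_
  have h1 : (2 * (1 + ‖a‖)) ^ i.1 ≤ (2 * (1 + ‖a‖)) ^ K :=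
    pow_le_pow_right₀ (by nlinarith [norm_nonneg a]) hi1
  calc (2 * (1 + ‖a‖)) ^ i.1 * (Finset.Iic (i.1, i.2)).sup (schwartzSeminormFamily 𝕜 V F) f
      ≤ (2 * (1 + ‖a‖)) ^ K * (Finset.Iic (K, L)).sup (schwartzSeminormFamily 𝕜 V F) f :=
        mul_le_mul h1 (sup_Iic_schwartzSeminorm_mono 𝕜 hi1 hi2 f) (apply_nonneg _ _)
          (by positivity)
    _ = 2 ^ K * (1 + ‖a‖) ^ K * (Finset.Iic (K, L)).sup (schwartzSeminormFamily 𝕜 V F) f := by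
        rw [mul_pow]

end Translate

/-! ### Localised translates decay -/

section Localise

variable {V F : Type*} [NormedAddCommGroup V] [NormedSpace ℝ V]
  [NormedAddCommGroup F] [NormedSpace ℝ F]
variable (𝕜 : Type*) [RCLike 𝕜] [NormedSpace 𝕜 F] [SMulCommClass ℝ 𝕜 F]

/-- **Decay of localised translates.** Let `χ : V → 𝕜` be smooth with compact support. For all
`k, l, N` there is `C` such that for all `a ∈ V` and `f ∈ 𝓢(V, F)`,
`‖χ · f(· - a)‖_{k,l} (1 + ‖a‖)^N ≤ C sup_{(k',l') ≤ (N,l)} ‖f‖_{k',l'}`: on the (bounded) support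
of `χ` the derivatives of `f(· - a)` are small by the Schwartz decay of `f` at distance `~‖a‖`.
[folklore] -/
theorem exists_bound_seminorm_smulLeftCLM_compSubConstCLM {χ : V → 𝕜} (hχ : ContDiff ℝ ∞ χ)
    (hχc : HasCompactSupport χ) (k l N : ℕ) :
    ∃ C : ℝ, 0 ≤ C ∧ ∀ (a : V) (f : 𝓢(V, F)),
      SchwartzMap.seminorm 𝕜 k l
          (SchwartzMap.smulLeftCLM F χ (SchwartzMap.compSubConstCLM 𝕜 a f)) * (1 + ‖a‖) ^ N ≤
        C * (Finset.Iic (N, l)).sup (schwartzSeminormFamily 𝕜 V F) f := by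
  -- a radius containing the support of `χ` and bounds on its derivatives
  obtain ⟨R₀, hR₀⟩ := isBounded_iff_forall_norm_le.1 hχc.isBounded
  set R : ℝ := max R₀ 0 with hR
  have hR0 : 0 ≤ R := le_max_right _ _
  have hsuppR : ∀ x ∈ tsupport χ, ‖x‖ ≤ R := fun x hx => (hR₀ x hx).trans (le_max_left _ _)
  have hA : ∀ j : ℕ, ∃ A : ℝ, ∀ x, ‖iteratedFDeriv ℝ j χ x‖ ≤ A := fun j => by
    obtain ⟨x₀, hx₀⟩ := ((hχ.continuous_iteratedFDeriv (m := j)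
      (by exact_mod_cast le_top)).norm).exists_forall_ge_of_hasCompactSupport
      ((hχc.iteratedFDeriv j).norm)
    exact ⟨_, hx₀⟩
  choose A hA using hA
  have hA0 : ∀ j, 0 ≤ A j := fun j => (norm_nonneg _).trans (hA j 0)
  have hχt : χ.HasTemperateGrowth := hχc.hasTemperateGrowth hχ
  set C : ℝ := (1 + R) ^ (k + N) * 2 ^ N * ∑ j ∈ Finset.range (l + 1), (l.choose j : ℝ) * A j
    with hC
  have hC0 : 0 ≤ C := by
    have : 0 ≤ ∑ j ∈ Finset.range (l + 1), (l.choose j : ℝ) * A j :=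
      Finset.sum_nonneg fun j _ => mul_nonneg (Nat.cast_nonneg _) (hA0 j)
    positivity
  refine ⟨C, hC0, fun a f => ?_⟩
  set S := (Finset.Iic (N, l)).sup (schwartzSeminormFamily 𝕜 V F) f with hS
  have hS0 : 0 ≤ S := apply_nonneg _ _
  have ha1 : (1 : ℝ) ≤ 1 + ‖a‖ := le_add_of_nonneg_right (norm_nonneg _)
  have hapos : 0 < (1 + ‖a‖) ^ N := by positivity
  rw [← le_div_iff₀ hapos]
  refine SchwartzMap.seminorm_le_bound 𝕜 k l _ (by positivity) fun x => ?_
  -- the function and its support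
  have hcoe : (SchwartzMap.smulLeftCLM F χ (SchwartzMap.compSubConstCLM 𝕜 a f) : V → F) =
      fun z => χ z • f (z - a) := by
    funext z
    rw [SchwartzMap.smulLeftCLM_apply_apply hχt]
    rfl
  rw [hcoe]
  by_cases hx : x ∈ tsupport χ
  · have hxR : ‖x‖ ≤ R := hsuppR x hx
    have hχl : ContDiff ℝ l χ := hχ.of_le (by exact_mod_cast le_top)
    have hgl : ContDiff ℝ l (fun z => f (z - a)) :=
      (f.smooth l).comp (contDiff_id.sub contDiff_const)
    have hleib := norm_iteratedFDeriv_smul_le (𝕜 := ℝ) hχl hgl x (n := l) le_rfl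
    -- decay of `f` at `x - a`
    have hdist : 1 + ‖a‖ ≤ (1 + R) * (1 + ‖x - a‖) := by
      have h1 : ‖a‖ ≤ ‖x - a‖ + ‖x‖ := by
        calc ‖a‖ = ‖x - (x - a)‖ := by rw [sub_sub_cancel]
          _ ≤ ‖x‖ + ‖x - a‖ := norm_sub_le _ _
          _ = ‖x - a‖ + ‖x‖ := add_comm _ _
      nlinarith [norm_nonneg (x - a), norm_nonneg x]
    have hdecay : ∀ i ≤ l, ‖iteratedFDeriv ℝ i f (x - a)‖ * (1 + ‖a‖) ^ N ≤
        (1 + R) ^ N * (2 ^ N * S) := by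
      intro i hi
      have h : (1 + ‖x - a‖) ^ N * ‖iteratedFDeriv ℝ i f (x - a)‖ ≤ 2 ^ N * S :=
        SchwartzMap.one_add_le_sup_seminorm_apply (𝕜 := 𝕜) (m := (N, l)) (k := N) (n := i)
          le_rfl hi f (x - a)
      calc ‖iteratedFDeriv ℝ i f (x - a)‖ * (1 + ‖a‖) ^ N
          ≤ ‖iteratedFDeriv ℝ i f (x - a)‖ * ((1 + R) * (1 + ‖x - a‖)) ^ N := by gcongr
        _ = (1 + R) ^ N * ((1 + ‖x - a‖) ^ N * ‖iteratedFDeriv ℝ i f (x - a)‖) := by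
            rw [mul_pow]; ring
        _ ≤ (1 + R) ^ N * (2 ^ N * S) := mul_le_mul_of_nonneg_left h (by positivity)
    have hD : ∀ i, iteratedFDeriv ℝ i (fun z => f (z - a)) x = iteratedFDeriv ℝ i f (x - a) :=
      fun i => by rw [iteratedFDeriv_comp_sub']
    -- assemble
    have hxk : ‖x‖ ^ k ≤ (1 + R) ^ k :=
      pow_le_pow_left₀ (norm_nonneg _) (hxR.trans (by linarith)) k
    have hterm : ∀ i ∈ Finset.range (l + 1),
        (l.choose i : ℝ) * ‖iteratedFDeriv ℝ i χ x‖ *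
            ‖iteratedFDeriv ℝ (l - i) (fun z => f (z - a)) x‖ ≤
          (l.choose i : ℝ) * A i * (((1 + R) ^ N * (2 ^ N * S)) / (1 + ‖a‖) ^ N) := by
      intro i _
      rw [hD]
      have h2 : ‖iteratedFDeriv ℝ (l - i) f (x - a)‖ ≤
          ((1 + R) ^ N * (2 ^ N * S)) / (1 + ‖a‖) ^ N := by
        rw [le_div_iff₀ hapos]
        exact hdecay (l - i) (Nat.sub_le l i)
      exact mul_le_mul (mul_le_mul_of_nonneg_left (hA i x) (Nat.cast_nonneg _)) h2
        (norm_nonneg _) (mul_nonneg (Nat.cast_nonneg _) (hA0 i))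
    calc ‖x‖ ^ k * ‖iteratedFDeriv ℝ l (fun z => χ z • f (z - a)) x‖
        ≤ (1 + R) ^ k * ∑ i ∈ Finset.range (l + 1), (l.choose i : ℝ) *
            ‖iteratedFDeriv ℝ i χ x‖ * ‖iteratedFDeriv ℝ (l - i) (fun z => f (z - a)) x‖ :=
          mul_le_mul hxk hleib (norm_nonneg _) (by positivity)
      _ ≤ (1 + R) ^ k * ∑ i ∈ Finset.range (l + 1), (l.choose i : ℝ) * A i *
            (((1 + R) ^ N * (2 ^ N * S)) / (1 + ‖a‖) ^ N) :=
          mul_le_mul_of_nonneg_left (Finset.sum_le_sum hterm) (by positivity)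
      _ = C * S / (1 + ‖a‖) ^ N := by
          rw [hC, ← Finset.sum_mul, div_eq_mul_inv, div_eq_mul_inv, pow_add]
          ring
  · -- outside the support everything vanishes
    have hsupp : Function.support (fun z => χ z • f (z - a)) ⊆ tsupport χ := fun z hz => by
      by_contra h
      exact hz (by simp [image_eq_zero_of_notMem_tsupport h])
    have hx' : x ∉ tsupport (fun z => χ z • f (z - a)) := fun h =>
      hx (closure_minimal hsupp (isClosed_tsupport χ) h)
    have h0 : iteratedFDeriv ℝ l (fun z => χ z • f (z - a)) x = 0 :=
      Function.notMem_support.1 fun h => hx' (support_iteratedFDeriv_subset l h)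
    rw [h0, norm_zero, mul_zero]
    positivity

/-- Finite-family form of `exists_bound_seminorm_smulLeftCLM_compSubConstCLM`: for a finite set
`s` of seminorms and every `N`, `sup_s ‖χ · f(· - a)‖ (1 + ‖a‖)^N ≤ C sup_{s'} ‖f‖`. [folklore] -/
theorem exists_bound_sup_seminorm_smulLeftCLM_compSubConstCLM {χ : V → 𝕜} (hχ : ContDiff ℝ ∞ χ)
    (hχc : HasCompactSupport χ) (s : Finset (ℕ × ℕ)) (N : ℕ) :
    ∃ (C : ℝ) (s' : Finset (ℕ × ℕ)), 0 ≤ C ∧ ∀ (a : V) (f : 𝓢(V, F)),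
      (s.sup (schwartzSeminormFamily 𝕜 V F))
          (SchwartzMap.smulLeftCLM F χ (SchwartzMap.compSubConstCLM 𝕜 a f)) * (1 + ‖a‖) ^ N ≤
        C * (s'.sup (schwartzSeminormFamily 𝕜 V F)) f := by
  set L : ℕ := s.sup Prod.snd with hL
  have h := fun i : ℕ × ℕ => exists_bound_seminorm_smulLeftCLM_compSubConstCLM 𝕜 (F := F) hχ hχc i.1 i.2 N
  choose C hC0 hC using h
  refine ⟨s.sum C, Finset.Iic (N, L), Finset.sum_nonneg fun i _ => hC0 i, fun a f => ?_⟩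
  have hapos : 0 < (1 + ‖a‖) ^ N := by positivity
  rw [← le_div_iff₀ hapos]
  refine Seminorm.finset_sup_apply_le (div_nonneg (mul_nonneg (Finset.sum_nonneg fun i _ => hC0 i)
    (apply_nonneg _ _)) hapos.le) fun i hi => ?_
  rw [SchwartzMap.schwartzSeminormFamily_apply, le_div_iff₀ hapos]
  refine (hC i a f).trans ?_
  have hi2 : i.2 ≤ L := Finset.le_sup (f := Prod.snd) hi
  calc C i * (Finset.Iic (N, i.2)).sup (schwartzSeminormFamily 𝕜 V F) f
      ≤ C i * (Finset.Iic (N, L)).sup (schwartzSeminormFamily 𝕜 V F) f :=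
        mul_le_mul_of_nonneg_left (sup_Iic_schwartzSeminorm_mono 𝕜 le_rfl hi2 f) (hC0 i)
    _ ≤ s.sum C * (Finset.Iic (N, L)).sup (schwartzSeminormFamily 𝕜 V F) f :=
        mul_le_mul_of_nonneg_right (Finset.single_le_sum (fun j _ => hC0 j) hi) (apply_nonneg _ _)

end Localise

/-! ### Removing a cutoff -/

section CutoffRemoval

variable {V F : Type*} [NormedAddCommGroup V] [NormedSpace ℝ V]
  [NormedAddCommGroup F] [NormedSpace ℝ F]
variable (𝕜 : Type*) [RCLike 𝕜] [NormedSpace 𝕜 F] [SMulCommClass ℝ 𝕜 F]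

/-- **Cutoffs equal to one on large balls can be removed**: if `W_i : V → 𝕜` are smooth, with
derivatives bounded uniformly in `i`, and `W_i = 1` on the ball of radius `r_i → ∞`, then
`W_i f → f` in `𝓢(V, F)` (Hörmander I, Lemma 7.1.8, quantitative form). [folklore] -/
theorem tendsto_smulLeftCLM_of_eq_one {ι : Type*} {L : Filter ι} (f : 𝓢(V, F)) (W : ι → V → 𝕜)
    (hW : ∀ i, ContDiff ℝ ∞ (W i)) (hWt : ∀ i, (W i).HasTemperateGrowth) (A : ℕ → ℝ)
    (hA : ∀ i j x, ‖iteratedFDeriv ℝ j (W i) x‖ ≤ A j) (r : ι → ℝ) (hr : Tendsto r L atTop)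
    (hW1 : ∀ i x, ‖x‖ ≤ r i → W i x = 1) :
    Tendsto (fun i => SchwartzMap.smulLeftCLM F (W i) f) L (𝓝 f) := by
  rcases isEmpty_or_nonempty ι with hι | hι
  · rw [L.filter_eq_bot_of_isEmpty]; exact tendsto_bot
  have hA0 : ∀ j, 0 ≤ A j := fun j => (norm_nonneg _).trans (hA (Classical.arbitrary ι) j 0)
  -- derivative bounds for `W_i - 1`
  have hDψ : ∀ i j x, ‖iteratedFDeriv ℝ j (fun y => W i y - 1) x‖ ≤ A j + 1 := by
    intro i j x
    have hsub : (fun y => W i y - 1) = W i - fun _ => (1 : 𝕜) := rfl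
    rw [hsub, iteratedFDeriv_sub_apply ((hW i).of_le (by exact_mod_cast le_top)).contDiffAt
      contDiffAt_const]
    refine (norm_sub_le _ _).trans (add_le_add (hA i j x) ?_)
    rcases Nat.eq_zero_or_pos j with rfl | hj
    · rw [norm_iteratedFDeriv_zero]; simp
    · rw [iteratedFDeriv_const_of_ne (Nat.pos_iff_ne_zero.1 hj)]; simp
  have hcoe : ∀ i, (⇑(SchwartzMap.smulLeftCLM F (W i) f - f) : V → F) =
      fun x => (W i x - 1) • f x := by
    intro i
    funext x
    simp only [sub_apply, SchwartzMap.smulLeftCLM_apply_apply (hWt i), sub_smul,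
      one_smul]
  -- the seminorm estimate `p_{k,n}(W_i f - f) ≤ K / r_i` for `r_i > 0`
  have hest : ∀ k n : ℕ, ∃ K : ℝ, 0 ≤ K ∧ ∀ i, 0 < r i →
      SchwartzMap.seminorm 𝕜 k n (SchwartzMap.smulLeftCLM F (W i) f - f) ≤ K / r i := by
    intro k n
    set S' := (Finset.Iic (k + 1, n)).sup (schwartzSeminormFamily 𝕜 V F) f with hS'
    have hS'0 : 0 ≤ S' := apply_nonneg _ _
    set K := (∑ j ∈ Finset.range (n + 1), (n.choose j : ℝ) * (A j + 1)) * S' with hK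
    have hK0 : 0 ≤ K := by
      refine mul_nonneg (Finset.sum_nonneg fun j _ => ?_) hS'0
      have := hA0 j
      positivity
    refine ⟨K, hK0, fun i hri => ?_⟩
    refine SchwartzMap.seminorm_le_bound 𝕜 k n _ (by positivity) fun x => ?_
    rw [hcoe i]
    by_cases hx : ‖x‖ < r i
    · have hsupp : Function.support (fun y => (W i y - 1) • f y) ⊆ (Metric.ball (0 : V) (r i))ᶜ := by
        intro y hy
        rw [mem_compl_iff, mem_ball_zero_iff, not_lt]
        by_contra h
        push Not at h
        exact hy (by change (W i y - 1) • f y = 0; rw [hW1 i y h.le, sub_self, zero_smul])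
      have hx' : x ∉ tsupport (fun y => (W i y - 1) • f y) := fun h =>
        (closure_minimal hsupp Metric.isOpen_ball.isClosed_compl h) (mem_ball_zero_iff.2 hx)
      have h0 : iteratedFDeriv ℝ n (fun y => (W i y - 1) • f y) x = 0 :=
        Function.notMem_support.1 fun h => hx' (support_iteratedFDeriv_subset n h)
      rw [h0, norm_zero, mul_zero]
      positivity
    · push Not at hx
      have hxpos : 0 < ‖x‖ := hri.trans_le hx
      have hψ : ContDiff ℝ n (fun y => W i y - 1) :=
        ((hW i).sub contDiff_const).of_le (by exact_mod_cast le_top)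
      have hleib := norm_iteratedFDeriv_smul_le (𝕜 := ℝ) hψ (f.smooth n) x (n := n) le_rfl
      have hterm : ∀ j ∈ Finset.range (n + 1),
          ‖x‖ ^ k * ((n.choose j : ℝ) * ‖iteratedFDeriv ℝ j (fun y => W i y - 1) x‖ *
            ‖iteratedFDeriv ℝ (n - j) f x‖) ≤ (n.choose j : ℝ) * (A j + 1) * (S' / r i) := by
        intro j _
        have h1 : ‖x‖ ^ k * ‖iteratedFDeriv ℝ (n - j) f x‖ ≤ S' / r i := by
          rw [le_div_iff₀ hri]
          have h2 : ‖x‖ ^ (k + 1) * ‖iteratedFDeriv ℝ (n - j) f x‖ ≤ S' :=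
            (SchwartzMap.le_seminorm 𝕜 (k + 1) (n - j) f x).trans
              (schwartzSeminorm_le_sup_Iic 𝕜 le_rfl (Nat.sub_le n j) f)
          calc ‖x‖ ^ k * ‖iteratedFDeriv ℝ (n - j) f x‖ * r i
              ≤ ‖x‖ ^ k * ‖iteratedFDeriv ℝ (n - j) f x‖ * ‖x‖ := by gcongr
            _ = ‖x‖ ^ (k + 1) * ‖iteratedFDeriv ℝ (n - j) f x‖ := by ring
            _ ≤ S' := h2
        calc ‖x‖ ^ k * ((n.choose j : ℝ) * ‖iteratedFDeriv ℝ j (fun y => W i y - 1) x‖ *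
              ‖iteratedFDeriv ℝ (n - j) f x‖)
            = (n.choose j : ℝ) * ‖iteratedFDeriv ℝ j (fun y => W i y - 1) x‖ *
                (‖x‖ ^ k * ‖iteratedFDeriv ℝ (n - j) f x‖) := by ring
          _ ≤ (n.choose j : ℝ) * (A j + 1) * (S' / r i) :=
              mul_le_mul (mul_le_mul_of_nonneg_left (hDψ i j x) (by positivity)) h1
                (by positivity) (by have := hA0 j; positivity)
      calc ‖x‖ ^ k * ‖iteratedFDeriv ℝ n (fun y => (W i y - 1) • f y) x‖
          ≤ ‖x‖ ^ k * ∑ j ∈ Finset.range (n + 1), (n.choose j : ℝ) *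
              ‖iteratedFDeriv ℝ j (fun y => W i y - 1) x‖ * ‖iteratedFDeriv ℝ (n - j) f x‖ := by
            gcongr
        _ = ∑ j ∈ Finset.range (n + 1), ‖x‖ ^ k * ((n.choose j : ℝ) *
              ‖iteratedFDeriv ℝ j (fun y => W i y - 1) x‖ * ‖iteratedFDeriv ℝ (n - j) f x‖) := by
            rw [Finset.mul_sum]
        _ ≤ ∑ j ∈ Finset.range (n + 1), (n.choose j : ℝ) * (A j + 1) * (S' / r i) :=
            Finset.sum_le_sum hterm
        _ = K / r i := by
            rw [hK, ← Finset.sum_mul]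
            ring
  -- conclusion
  rw [(schwartz_withSeminorms 𝕜 V F).tendsto_nhds]
  rintro ⟨k, n⟩ ε hε
  obtain ⟨K, hK0, hK⟩ := hest k n
  filter_upwards [hr.eventually_gt_atTop (max 1 (K / ε))] with i hi
  have hri : 0 < r i := lt_of_le_of_lt (by positivity) ((le_max_left _ _).trans_lt hi)
  rw [SchwartzMap.schwartzSeminormFamily_apply]
  calc SchwartzMap.seminorm 𝕜 k n (SchwartzMap.smulLeftCLM F (W i) f - f) ≤ K / r i := hK i hri
    _ < ε := by
        rw [div_lt_iff₀ hri]
        have h := (le_max_right 1 (K / ε)).trans_lt hi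
        rw [div_lt_iff₀ hε] at h
        linarith

end CutoffRemoval

/-! ### Derivative bounds for products and real-to-`𝕜` coercions -/

section ProdBounds

variable {X : Type*} [NormedAddCommGroup X] [NormedSpace ℝ X]

/-- **Uniform Leibniz bounds for products**: given bounds `A j` there are bounds `A' j` such that
any product of at most `N` smooth real functions whose derivatives are bounded by `A` has
derivatives bounded by `A'`. [folklore] -/
theorem exists_bound_iteratedFDeriv_prod {ι' : Type*} (A : ℕ → ℝ) (N : ℕ) :
    ∃ A' : ℕ → ℝ, ∀ (s : Finset ι'), s.card ≤ N → ∀ (u : ι' → X → ℝ),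
      (∀ i ∈ s, ContDiff ℝ ∞ (u i)) → (∀ i ∈ s, ∀ j x, ‖iteratedFDeriv ℝ j (u i) x‖ ≤ A j) →
        ∀ j x, ‖iteratedFDeriv ℝ j (fun x => ∏ i ∈ s, u i x) x‖ ≤ A' j := by
  classical
  have hconst : ∀ j (x : X), ‖iteratedFDeriv ℝ j (fun _ : X => (1 : ℝ)) x‖ ≤ 1 := by
    intro j x
    rcases Nat.eq_zero_or_pos j with rfl | hj
    · rw [norm_iteratedFDeriv_zero]; simp
    · rw [iteratedFDeriv_const_of_ne (Nat.pos_iff_ne_zero.1 hj)]; simp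
  induction N with
  | zero =>
    refine ⟨fun _ => 1, fun s hs u _ _ j x => ?_⟩
    rw [Finset.card_eq_zero.1 (Nat.le_zero.1 hs)]
    simpa using hconst j x
  | succ N ih =>
    obtain ⟨A', hA'⟩ := ih
    refine ⟨fun j => max 1 (∑ i ∈ Finset.range (j + 1), (j.choose i : ℝ) * A i * A' (j - i)),
      fun s hs u hu hA j x => ?_⟩
    rcases s.eq_empty_or_nonempty with rfl | ⟨a, ha⟩
    · simpa using (hconst j x).trans (le_max_left _ _)
    · have hs' : (s.erase a).card ≤ N := by
        rw [Finset.card_erase_of_mem ha]; omega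
      have hprod : (fun x => ∏ i ∈ s, u i x) = fun x => u a x * ∏ i ∈ s.erase a, u i x := by
        funext x; rw [← Finset.mul_prod_erase _ _ ha]
      rw [hprod]
      have hP : ContDiff ℝ ∞ (fun x => ∏ i ∈ s.erase a, u i x) :=
        contDiff_prod fun i hi => hu i (Finset.mem_of_mem_erase hi)
      have hPb := hA' (s.erase a) hs' u (fun i hi => hu i (Finset.mem_of_mem_erase hi))
        (fun i hi => hA i (Finset.mem_of_mem_erase hi))
      refine le_trans ?_ (le_max_right _ _)
      refine (norm_iteratedFDeriv_mul_le (hu a ha) hP x (n := j) (mod_cast le_top)).trans ?_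
      refine Finset.sum_le_sum fun i _ => ?_
      have hA0 : 0 ≤ A i := (norm_nonneg _).trans (hA a ha i x)
      exact mul_le_mul (mul_le_mul_of_nonneg_left (hA a ha i x) (Nat.cast_nonneg _)) (hPb _ _)
        (norm_nonneg _) (mul_nonneg (Nat.cast_nonneg _) hA0)

variable (𝕜 : Type*) [RCLike 𝕜]

/-- Coercing a smooth real function into `𝕜` keeps it smooth. [folklore] -/
theorem contDiff_ofReal_comp {W : X → ℝ} {n : WithTop ℕ∞} (hW : ContDiff ℝ n W) :
    ContDiff ℝ n fun x => ((W x : ℝ) : 𝕜) :=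
  (RCLike.ofRealCLM (K := 𝕜)).contDiff.comp hW

/-- Coercing into `𝕜` preserves the norms of all derivatives. [folklore] -/
theorem norm_iteratedFDeriv_ofReal_comp {W : X → ℝ} (hW : ContDiff ℝ ∞ W) (j : ℕ) (x : X) :
    ‖iteratedFDeriv ℝ j (fun x => ((W x : ℝ) : 𝕜)) x‖ = ‖iteratedFDeriv ℝ j W x‖ := by
  have h : (fun x => ((W x : ℝ) : 𝕜)) = (RCLike.ofRealLI (K := 𝕜)) ∘ W := by
    funext x; simp [RCLike.ofRealLI_apply]
  rw [h]
  exact (RCLike.ofRealLI (K := 𝕜)).norm_iteratedFDeriv_comp_left (hW.contDiffAt) (mod_cast le_top)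

/-- A smooth function with bounded derivatives of every order has temperate growth. [folklore] -/
theorem hasTemperateGrowth_of_bounds {F' : Type*} [NormedAddCommGroup F'] [NormedSpace ℝ F']
    {W : X → F'} (hW : ContDiff ℝ ∞ W) (A : ℕ → ℝ) (hA : ∀ j x, ‖iteratedFDeriv ℝ j W x‖ ≤ A j) :
    W.HasTemperateGrowth :=
  ⟨hW, fun j => ⟨0, A j, fun x => by simpa using hA j x⟩⟩

end ProdBounds

/-! ### The smooth step, the bump `ρ` and the windows -/

section OneDim

/-- The bump `ρ(t) = σ(t + 1) - σ(t)` built from Mathlib's smooth step `σ = Real.smoothTransition`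
(`σ = 0` on `(-∞, 0]`, `σ = 1` on `[1, ∞)`): `ρ ≥ 0`, `supp ρ ⊆ [-1, 1]` and the integer translates
of `ρ` sum to `1` (telescoping). [folklore] -/
def pouBump (t : ℝ) : ℝ := Real.smoothTransition (t + 1) - Real.smoothTransition t

/-- The window `w_R(t) = σ(t + R + 1) - σ(t - R)`: equal to `1` on `[-R, R]`, to `0` outside
`(-R - 1, R + 1)`; it is the sum of the translates `ρ(· - j)`, `|j| ≤ R`. [folklore] -/
def pouWindow (R : ℝ) (t : ℝ) : ℝ := Real.smoothTransition (t + R + 1) - Real.smoothTransition (t - R)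

/-- `ρ` is smooth. [folklore] -/
theorem contDiff_pouBump {n : ℕ∞} : ContDiff ℝ n pouBump :=
  (Real.smoothTransition.contDiff.comp (contDiff_id.add contDiff_const)).sub
    Real.smoothTransition.contDiff

/-- `w_R` is smooth. [folklore] -/
theorem contDiff_pouWindow (R : ℝ) {n : ℕ∞} : ContDiff ℝ n (pouWindow R) :=
  (Real.smoothTransition.contDiff.comp ((contDiff_id.add contDiff_const).add contDiff_const)).sub
    (Real.smoothTransition.contDiff.comp (contDiff_id.sub contDiff_const))

/-- `ρ ≥ 0`. [folklore] -/
theorem pouBump_nonneg (t : ℝ) : 0 ≤ pouBump t :=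
  sub_nonneg.2 (Real.smoothTransition.monotone (by linarith))

/-- `ρ(t) = 0` for `t ≤ -1`. [folklore] -/
theorem pouBump_eq_zero_of_le {t : ℝ} (ht : t ≤ -1) : pouBump t = 0 := by
  rw [pouBump, Real.smoothTransition.zero_of_nonpos (by linarith),
    Real.smoothTransition.zero_of_nonpos (by linarith), sub_zero]

/-- `ρ(t) = 0` for `t ≥ 1`. [folklore] -/
theorem pouBump_eq_zero_of_ge {t : ℝ} (ht : 1 ≤ t) : pouBump t = 0 := by
  rw [pouBump, Real.smoothTransition.one_of_one_le (by linarith),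
    Real.smoothTransition.one_of_one_le ht, sub_self]

/-- `supp ρ ⊆ [-1, 1]`. [folklore] -/
theorem tsupport_pouBump_subset : tsupport pouBump ⊆ Icc (-1) 1 := by
  refine closure_minimal (fun t ht => ?_) isClosed_Icc
  rw [Function.mem_support] at ht
  constructor
  · by_contra h; exact ht (pouBump_eq_zero_of_le (le_of_not_ge h))
  · by_contra h; exact ht (pouBump_eq_zero_of_ge (le_of_not_ge h))

/-- `w_R = 1` on `[-R, R]`. [folklore] -/
theorem pouWindow_eq_one {R t : ℝ} (ht : |t| ≤ R) : pouWindow R t = 1 := by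
  rw [abs_le] at ht
  rw [pouWindow, Real.smoothTransition.one_of_one_le (by linarith),
    Real.smoothTransition.zero_of_nonpos (by linarith), sub_zero]

/-- **Telescoping**: `∑_{|j| ≤ R} ρ(t - j) = w_R(t)`. [folklore] -/
theorem sum_Icc_pouBump (R : ℕ) (t : ℝ) :
    ∑ j ∈ Finset.Icc (-(R : ℤ)) R, pouBump (t - j) = pouWindow R t := by
  have hIcc : Finset.Icc (-(R : ℤ)) R = (Finset.range (2 * R + 1)).image fun i : ℕ => (i : ℤ) - R := by
    ext j
    simp only [Finset.mem_Icc, Finset.mem_image, Finset.mem_range]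
    constructor
    · rintro ⟨h1, h2⟩
      exact ⟨(j + R).toNat, by omega, by omega⟩
    · rintro ⟨i, hi, rfl⟩
      omega
  rw [hIcc, Finset.sum_image fun i _ i' _ h => by simpa using h]
  have hterm : ∀ i : ℕ, pouBump (t - (((i : ℤ) - R : ℤ) : ℝ)) =
      Real.smoothTransition (t + R + 1 - i) - Real.smoothTransition (t + R + 1 - (i + 1 : ℕ)) := by
    intro i
    simp only [pouBump]
    push_cast
    ring_nf
  simp only [hterm]
  rw [Finset.sum_range_sub' (fun i : ℕ => Real.smoothTransition (t + R + 1 - i))]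
  simp only [pouWindow]
  push_cast
  ring_nf

/-- The derivatives of the smooth step are bounded (they vanish off `[0, 1]`). [folklore] -/
theorem exists_bound_iteratedFDeriv_smoothTransition (j : ℕ) :
    ∃ B : ℝ, ∀ t, ‖iteratedFDeriv ℝ j Real.smoothTransition t‖ ≤ B := by
  rcases Nat.eq_zero_or_pos j with rfl | hj
  · refine ⟨1, fun t => ?_⟩
    rw [norm_iteratedFDeriv_zero, Real.norm_of_nonneg (Real.smoothTransition.nonneg t)]
    exact Real.smoothTransition.le_one t
  -- for `j ≥ 1` the derivative is continuous and vanishes outside `[0, 1]`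
  set g : ℝ → ℝ := fun t => ‖iteratedFDeriv ℝ j Real.smoothTransition t‖ with hg
  have hgc : Continuous g :=
    (Real.smoothTransition.contDiff.continuous_iteratedFDeriv (m := j) (mod_cast le_top)).norm
  have hzero : ∀ t, t ∉ Icc (0 : ℝ) 1 → g t = 0 := by
    intro t ht
    simp only [hg, norm_eq_zero]
    rw [mem_Icc, not_and_or, not_le, not_le] at ht
    rcases ht with ht | ht
    · have heq : Real.smoothTransition =ᶠ[𝓝 t] fun _ => (0 : ℝ) := by
        filter_upwards [Iio_mem_nhds ht] with s hs
        exact Real.smoothTransition.zero_of_nonpos hs.le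
      rw [(heq.iteratedFDeriv ℝ j).eq_of_nhds, iteratedFDeriv_const_of_ne (Nat.pos_iff_ne_zero.1 hj)]
      rfl
    · have heq : Real.smoothTransition =ᶠ[𝓝 t] fun _ => (1 : ℝ) := by
        filter_upwards [Ioi_mem_nhds ht] with s hs
        exact Real.smoothTransition.one_of_one_le hs.le
      rw [(heq.iteratedFDeriv ℝ j).eq_of_nhds, iteratedFDeriv_const_of_ne (Nat.pos_iff_ne_zero.1 hj)]
      rfl
  obtain ⟨t₀, _, ht₀⟩ := isCompact_Icc.exists_isMaxOn (Set.nonempty_Icc.2 zero_le_one) hgc.continuousOn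
  refine ⟨g t₀, fun t => ?_⟩
  by_cases ht : t ∈ Icc (0 : ℝ) 1
  · exact ht₀ ht
  · rw [show ‖iteratedFDeriv ℝ j Real.smoothTransition t‖ = g t from rfl, hzero t ht]
    exact norm_nonneg _

/-- **The windows have derivatives bounded uniformly in `R`.** [folklore] -/
theorem exists_bound_iteratedFDeriv_pouWindow (j : ℕ) :
    ∃ B : ℝ, ∀ R t, ‖iteratedFDeriv ℝ j (pouWindow R) t‖ ≤ B := by
  obtain ⟨B, hB⟩ := exists_bound_iteratedFDeriv_smoothTransition j
  refine ⟨B + B, fun R t => ?_⟩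
  have h1 : (fun t => Real.smoothTransition (t + R + 1)) = fun t => Real.smoothTransition (t + (R + 1)) := by
    funext t; ring_nf
  have hsub : pouWindow R = (fun t => Real.smoothTransition (t + (R + 1))) -
      fun t => Real.smoothTransition (t - R) := by
    funext t; simp only [pouWindow, Pi.sub_apply]; ring_nf
  have hf1 : ContDiff ℝ ∞ (fun t => Real.smoothTransition (t + (R + 1))) :=
    Real.smoothTransition.contDiff.comp (contDiff_id.add contDiff_const)
  have hf2 : ContDiff ℝ ∞ (fun t => Real.smoothTransition (t - R)) :=
    Real.smoothTransition.contDiff.comp (contDiff_id.sub contDiff_const)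
  rw [hsub, iteratedFDeriv_sub_apply (hf1.contDiffAt.of_le (mod_cast le_top))
    (hf2.contDiffAt.of_le (mod_cast le_top))]
  refine (norm_sub_le _ _).trans (add_le_add ?_ ?_)
  · rw [iteratedFDeriv_comp_add_right]; exact hB _
  · rw [iteratedFDeriv_comp_sub]; exact hB _

/-- The derivatives of `ρ` are bounded. [folklore] -/
theorem exists_bound_iteratedFDeriv_pouBump (j : ℕ) :
    ∃ B : ℝ, ∀ t, ‖iteratedFDeriv ℝ j pouBump t‖ ≤ B := by
  obtain ⟨B, hB⟩ := exists_bound_iteratedFDeriv_pouWindow j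
  refine ⟨B, fun t => ?_⟩
  have h : pouBump = pouWindow 0 := by
    funext t; simp [pouBump, pouWindow]
  rw [h]
  exact hB 0 t

end OneDim

/-! ### The lattice partition of unity on a finite-dimensional space -/

section Lattice

variable {E : Type*} [NormedAddCommGroup E] [NormedSpace ℝ E] {m : ℕ}
  (Λ : E ≃L[ℝ] EuclideanSpace ℝ (Fin m))

/-- The partition functions `η_β(y) = ∏_c ρ(Λ(y)_c - β_c)`, `β ∈ ℤᵐ`, attached to linear
coordinates `Λ : E ≃ ℝᵐ`. [folklore] -/
def latticeBump (β : Fin m → ℤ) (y : E) : ℝ := ∏ c, pouBump ((Λ y) c - β c)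

/-- The windows `W_R(y) = ∏_c w_R(Λ(y)_c) = ∑_{β ∈ [-R, R]ᵐ} η_β(y)`. [folklore] -/
def latticeWindow (R : ℕ) (y : E) : ℝ := ∏ c, pouWindow R ((Λ y) c)

/-- The discrete cube `[-R, R]ᵐ ∩ ℤᵐ`. [folklore] -/
def latticeCube (m R : ℕ) : Finset (Fin m → ℤ) := Fintype.piFinset fun _ => Finset.Icc (-(R : ℤ)) R

/-- **Sum over a cube of the partition functions**: `∑_{β ∈ [-R,R]ᵐ} η_β = W_R`. [folklore] -/
theorem sum_latticeCube_latticeBump (R : ℕ) (y : E) :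
    ∑ β ∈ latticeCube m R, latticeBump Λ β y = latticeWindow Λ R y := by
  simp only [latticeBump, latticeWindow, latticeCube]
  rw [← Finset.prod_univ_sum (fun _ => Finset.Icc (-(R : ℤ)) R) fun c j => pouBump ((Λ y) c - j)]
  exact Finset.prod_congr rfl fun c _ => sum_Icc_pouBump R _

/-- The discrete cubes exhaust `ℤᵐ`. [folklore] -/
theorem tendsto_latticeCube_atTop : Tendsto (latticeCube m) atTop atTop := by
  refine Monotone.tendsto_atTop_atTop (fun R R' h => ?_) fun s => ?_
  · exact Fintype.piFinset_subset _ _ fun _ => Finset.Icc_subset_Icc (by omega) (by omega)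
  · obtain ⟨R, hR⟩ : ∃ R : ℕ, ∀ β ∈ s, ∀ c, |β c| ≤ R := by
      refine ⟨∑ β ∈ s, ∑ c, (β c).natAbs, fun β hβ c => ?_⟩
      have h1 : (β c).natAbs ≤ ∑ c', (β c').natAbs :=
        Finset.single_le_sum (f := fun c' => (β c').natAbs) (fun _ _ => Nat.zero_le _)
          (Finset.mem_univ c)
      have h2 : ∑ c', (β c').natAbs ≤ ∑ β' ∈ s, ∑ c', (β' c').natAbs :=
        Finset.single_le_sum (f := fun β' : Fin m → ℤ => ∑ c', (β' c').natAbs)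
          (fun _ _ => Nat.zero_le _) hβ
      rw [Int.abs_eq_natAbs]
      exact_mod_cast h1.trans h2
    refine ⟨R, fun β hβ => Fintype.mem_piFinset.2 fun c => Finset.mem_Icc.2 ?_⟩
    have := abs_le.1 (hR β hβ c)
    constructor <;> omega

/-- Coordinate bounds control the Euclidean norm: `|z_c| ≤ M` for all `c` gives `‖z‖ ≤ √m · M`. [folklore] -/
theorem EuclideanSpace.norm_le_sqrt_card_mul {ι : Type*} [Fintype ι] (z : EuclideanSpace ℝ ι) {M : ℝ}
    (hM : 0 ≤ M) (h : ∀ c, |z c| ≤ M) : ‖z‖ ≤ √(Fintype.card ι) * M := by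
  rw [EuclideanSpace.norm_eq]
  have hsum : ∑ c, ‖z c‖ ^ 2 ≤ Fintype.card ι * M ^ 2 := by
    calc ∑ c, ‖z c‖ ^ 2 ≤ ∑ _c : ι, M ^ 2 := Finset.sum_le_sum fun c _ => by
            rw [Real.norm_eq_abs]
            exact pow_le_pow_left₀ (abs_nonneg _) (h c) 2
      _ = Fintype.card ι * M ^ 2 := by rw [Finset.sum_const, Finset.card_univ, nsmul_eq_mul]
  calc √(∑ c, ‖z c‖ ^ 2) ≤ √(Fintype.card ι * M ^ 2) := Real.sqrt_le_sqrt hsum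
    _ = √(Fintype.card ι) * M := by
        rw [Real.sqrt_mul (Nat.cast_nonneg _), Real.sqrt_sq hM]

/-- `η_β` is smooth. [folklore] -/
theorem contDiff_latticeBump (β : Fin m → ℤ) {n : ℕ∞} : ContDiff ℝ n (latticeBump Λ β) := by
  unfold latticeBump
  refine contDiff_prod fun c _ => contDiff_pouBump.comp ?_
  exact (((EuclideanSpace.proj c).contDiff.comp Λ.contDiff).sub contDiff_const)

/-- `W_R` is smooth. [folklore] -/
theorem contDiff_latticeWindow (R : ℕ) {n : ℕ∞} : ContDiff ℝ n (latticeWindow Λ R) := by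
  unfold latticeWindow
  refine contDiff_prod fun c _ => (contDiff_pouWindow (R : ℝ)).comp ?_
  exact ((EuclideanSpace.proj c).contDiff.comp Λ.contDiff)

/-- `η_β ≥ 0`. [folklore] -/
theorem latticeBump_nonneg (β : Fin m → ℤ) (y : E) : 0 ≤ latticeBump Λ β y :=
  Finset.prod_nonneg fun _ _ => pouBump_nonneg _

/-- **Support of `η_β`**: `supp η_β ⊆ {y | ∀ c, Λ(y)_c - β_c ∈ [-1, 1]}`. [folklore] -/
theorem tsupport_latticeBump_subset (β : Fin m → ℤ) :
    tsupport (latticeBump Λ β) ⊆ {y | ∀ c, (Λ y) c - β c ∈ Icc (-1 : ℝ) 1} := by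
  have hcl : IsClosed {y : E | ∀ c, (Λ y) c - β c ∈ Icc (-1 : ℝ) 1} := by
    simp only [setOf_forall]
    refine isClosed_iInter fun c => isClosed_Icc.preimage ?_
    exact (((EuclideanSpace.proj c).continuous.comp Λ.continuous).sub continuous_const)
  refine closure_minimal (fun y hy c => ?_) hcl
  rw [Function.mem_support] at hy
  have hc : pouBump ((Λ y) c - β c) ≠ 0 := fun h0 =>
    hy (Finset.prod_eq_zero (Finset.mem_univ c) h0)
  exact tsupport_pouBump_subset (subset_tsupport _ hc)

/-- Points of `supp η_β` have bounded norm when `|β_c| ≤ M`. [folklore] -/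
theorem norm_le_of_mem_tsupport_latticeBump {β : Fin m → ℤ} {y : E}
    (hy : y ∈ tsupport (latticeBump Λ β)) {M : ℝ} (hM0 : 0 ≤ M) (hM : ∀ c, |(β c : ℝ)| ≤ M) :
    ‖y‖ ≤ ‖(Λ.symm : EuclideanSpace ℝ (Fin m) →L[ℝ] E)‖ * (√m * (M + 1)) := by
  have h := tsupport_latticeBump_subset Λ β hy
  have hz : ‖Λ y‖ ≤ √m * (M + 1) := by
    have h' := EuclideanSpace.norm_le_sqrt_card_mul (Λ y) (by positivity : 0 ≤ M + 1) fun c => by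
      have h1 := h c
      have h2 := abs_le.1 (hM c)
      rw [mem_Icc] at h1
      rw [abs_le]
      constructor <;> linarith [h1.1, h1.2, h2.1, h2.2]
    simpa using h'
  calc ‖y‖ = ‖Λ.symm (Λ y)‖ := by rw [ContinuousLinearEquiv.symm_apply_apply]
    _ ≤ ‖(Λ.symm : EuclideanSpace ℝ (Fin m) →L[ℝ] E)‖ * ‖Λ y‖ :=
        Λ.symm.toContinuousLinearMap.le_opNorm _
    _ ≤ ‖(Λ.symm : EuclideanSpace ℝ (Fin m) →L[ℝ] E)‖ * (√m * (M + 1)) := by gcongr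

variable [FiniteDimensional ℝ E]

/-- `η_β` has compact support. [folklore] -/
theorem hasCompactSupport_latticeBump (β : Fin m → ℤ) : HasCompactSupport (latticeBump Λ β) := by
  set M : ℝ := ∑ c, |(β c : ℝ)| with hM
  have hM0 : 0 ≤ M := Finset.sum_nonneg fun c _ => abs_nonneg _
  have hMc : ∀ c, |(β c : ℝ)| ≤ M := fun c =>
    Finset.single_le_sum (f := fun c => |(β c : ℝ)|) (fun _ _ => abs_nonneg _) (Finset.mem_univ c)
  refine IsCompact.of_isClosed_subset (isCompact_closedBall (0 : E)
    (‖(Λ.symm : EuclideanSpace ℝ (Fin m) →L[ℝ] E)‖ * (√m * (M + 1)))) (isClosed_tsupport _) ?_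
  intro y hy
  rw [mem_closedBall_zero_iff]
  exact norm_le_of_mem_tsupport_latticeBump Λ hy hM0 hMc

omit [FiniteDimensional ℝ E] in
/-- `η_β` is the translate of `η_0` by the lattice vector `Λ⁻¹ β`. [folklore] -/
theorem latticeBump_eq_comp_sub (β : Fin m → ℤ) (y : E) :
    latticeBump Λ β y = latticeBump Λ 0 (y - Λ.symm (intVec β)) := by
  simp only [latticeBump, map_sub, ContinuousLinearEquiv.apply_symm_apply, PiLp.sub_apply,
    intVec_apply, Pi.zero_apply, Int.cast_zero, sub_zero]

omit [FiniteDimensional ℝ E] in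
/-- **The windows have derivatives bounded uniformly in `R`** (on `E`, through `Λ`). [folklore] -/
theorem exists_bound_iteratedFDeriv_latticeWindow (j : ℕ) :
    ∃ B : ℝ, ∀ R y, ‖iteratedFDeriv ℝ j (latticeWindow Λ R) y‖ ≤ B := by
  -- one-dimensional bounds
  have h1 : ∀ i, ∃ B, ∀ (R : ℕ) t, ‖iteratedFDeriv ℝ i (pouWindow R) t‖ ≤ B := fun i => by
    obtain ⟨B, hB⟩ := exists_bound_iteratedFDeriv_pouWindow i
    exact ⟨B, fun R t => hB R t⟩
  choose A hA using h1
  -- the factors `z ↦ w_R(z_c)` on `ℝᵐ`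
  have hproj : ∀ c : Fin m, ContDiff ℝ ∞ (fun z : EuclideanSpace ℝ (Fin m) => z c) := fun c =>
    (EuclideanSpace.proj (𝕜 := ℝ) (ι := Fin m) c).contDiff
  have hprojn : ∀ c : Fin m, ‖(EuclideanSpace.proj c : EuclideanSpace ℝ (Fin m) →L[ℝ] ℝ)‖ ≤ 1 :=
    fun c => ContinuousLinearMap.opNorm_le_bound _ zero_le_one fun z => by
      simpa using PiLp.norm_apply_le z c
  have hfac : ∀ (R : ℕ) (c : Fin m) (i : ℕ) (z : EuclideanSpace ℝ (Fin m)),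
      ‖iteratedFDeriv ℝ i (fun z : EuclideanSpace ℝ (Fin m) => pouWindow R (z c)) z‖ ≤ A i := by
    intro R c i z
    have hcomp : (fun z : EuclideanSpace ℝ (Fin m) => pouWindow R (z c)) =
        pouWindow R ∘ (EuclideanSpace.proj c : EuclideanSpace ℝ (Fin m) →L[ℝ] ℝ) := rfl
    rw [hcomp, (EuclideanSpace.proj c : EuclideanSpace ℝ (Fin m) →L[ℝ] ℝ).iteratedFDeriv_comp_right
      (contDiff_pouWindow (R : ℝ)) z (i := i) (mod_cast le_top)]
    refine (ContinuousMultilinearMap.norm_compContinuousLinearMap_le _ _).trans ?_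
    refine (mul_le_of_le_one_right (norm_nonneg _) ?_).trans (hA i R _)
    exact Finset.prod_le_one (fun _ _ => norm_nonneg _) fun _ _ => hprojn c
  obtain ⟨A', hA'⟩ := exists_bound_iteratedFDeriv_prod (X := EuclideanSpace ℝ (Fin m))
    (ι' := Fin m) A m
  have hP : ∀ (R : ℕ) i (z : EuclideanSpace ℝ (Fin m)),
      ‖iteratedFDeriv ℝ i (fun z : EuclideanSpace ℝ (Fin m) => ∏ c, pouWindow R (z c)) z‖ ≤ A' i :=
    fun R => hA' Finset.univ (by simp) (fun c z => pouWindow R (z c))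
      (fun c _ => (contDiff_pouWindow (R : ℝ)).comp (hproj c))
      (fun c _ i z => hfac R c i z)
  refine ⟨A' j * ‖(Λ : E →L[ℝ] EuclideanSpace ℝ (Fin m))‖ ^ j, fun R y => ?_⟩
  have hcomp : latticeWindow Λ R =
      (fun z : EuclideanSpace ℝ (Fin m) => ∏ c, pouWindow R (z c)) ∘ (Λ : E →L[ℝ] EuclideanSpace ℝ (Fin m)) := rfl
  have hsm : ContDiff ℝ ∞ (fun z : EuclideanSpace ℝ (Fin m) => ∏ c, pouWindow R (z c)) :=
    contDiff_prod fun c _ => (contDiff_pouWindow (R : ℝ)).comp (hproj c)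
  rw [hcomp, (Λ : E →L[ℝ] EuclideanSpace ℝ (Fin m)).iteratedFDeriv_comp_right hsm y (i := j)
    (mod_cast le_top)]
  refine (ContinuousMultilinearMap.norm_compContinuousLinearMap_le _ _).trans ?_
  rw [Finset.prod_const, Finset.card_univ, Fintype.card_fin]
  exact mul_le_mul_of_nonneg_right (hP R j _) (by positivity)

omit [FiniteDimensional ℝ E] in
/-- `W_R = 1` on the ball of radius `R / (‖Λ‖ + 1)`. [folklore] -/
theorem latticeWindow_eq_one {R : ℕ} {y : E}
    (hy : ‖y‖ ≤ R / (‖(Λ : E →L[ℝ] EuclideanSpace ℝ (Fin m))‖ + 1)) : latticeWindow Λ R y = 1 := by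
  have hΛ : 0 ≤ ‖(Λ : E →L[ℝ] EuclideanSpace ℝ (Fin m))‖ := norm_nonneg _
  have hyR : ‖Λ y‖ ≤ R := by
    calc ‖Λ y‖ ≤ ‖(Λ : E →L[ℝ] EuclideanSpace ℝ (Fin m))‖ * ‖y‖ := Λ.toContinuousLinearMap.le_opNorm y
      _ ≤ (‖(Λ : E →L[ℝ] EuclideanSpace ℝ (Fin m))‖ + 1) * ‖y‖ := by gcongr; linarith
      _ ≤ (‖(Λ : E →L[ℝ] EuclideanSpace ℝ (Fin m))‖ + 1) *
          (R / (‖(Λ : E →L[ℝ] EuclideanSpace ℝ (Fin m))‖ + 1)) := by gcongr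
      _ = R := by field_simp
  refine Finset.prod_eq_one fun c _ => pouWindow_eq_one ?_
  calc |(Λ y) c| = ‖(Λ y) c‖ := (Real.norm_eq_abs _).symm
    _ ≤ ‖Λ y‖ := PiLp.norm_apply_le _ _
    _ ≤ R := hyR

variable (𝕜 : Type*) [RCLike 𝕜] {F : Type*} [NormedAddCommGroup F] [NormedSpace ℝ F]
  [NormedSpace 𝕜 F] [SMulCommClass ℝ 𝕜 F]

omit [FiniteDimensional ℝ E] in
/-- **Convergence of the lattice partition of unity on Schwartz space**: for `g ∈ 𝓢(E, F)`,
`W_R · g = (∑_{β ∈ [-R,R]ᵐ} η_β) · g → g` in `𝓢(E, F)` as `R → ∞`. [folklore] -/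
theorem tendsto_latticeWindow_smul (g : 𝓢(E, F)) :
    Tendsto (fun R : ℕ => SchwartzMap.smulLeftCLM F (fun y => ((latticeWindow Λ R y : ℝ) : 𝕜)) g)
      atTop (𝓝 g) := by
  have hB := fun j => exists_bound_iteratedFDeriv_latticeWindow Λ j
  choose B hB using hB
  have hsm : ∀ R : ℕ, ContDiff ℝ ∞ (fun y => ((latticeWindow Λ R y : ℝ) : 𝕜)) := fun R =>
    contDiff_ofReal_comp 𝕜 (contDiff_latticeWindow Λ R)
  have hbd : ∀ (R : ℕ) j y, ‖iteratedFDeriv ℝ j (fun y => ((latticeWindow Λ R y : ℝ) : 𝕜)) y‖ ≤ B j := by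
    intro R j y
    rw [norm_iteratedFDeriv_ofReal_comp 𝕜 (contDiff_latticeWindow Λ R)]
    exact hB j R y
  refine tendsto_smulLeftCLM_of_eq_one 𝕜 g _ hsm
    (fun R => hasTemperateGrowth_of_bounds (hsm R) B (hbd R)) B hbd
    (fun R : ℕ => (R : ℝ) / (‖(Λ : E →L[ℝ] EuclideanSpace ℝ (Fin m))‖ + 1)) ?_ ?_
  · exact tendsto_natCast_atTop_atTop.atTop_div_const (by positivity)
  · intro R y hy
    rw [latticeWindow_eq_one Λ hy, RCLike.ofReal_one]

end Lattice

end Literature.MathematicalPhysics.QuantumLattice
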